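import Literature.Geometry.DiscreteGeometry.TwoShellChartSemantics
import Literature.MathematicalPhysics.StatisticalMechanics.BarlowStacking

/-!
# Local charts of two-shell-good configurations — the TEMPLATE of a context

Topic `Literature/Geometry/DiscreteGeometry`; companion of `TwoShellChartCheck.lean` / `TwoShellChartSemantics.lean`.
A context `κ = (flip, s₋₂, s₋₁, s₀, s₁)` of the checker names an ideal Barlow template through the centre: the Hägg word
`ctxWord κ` (the four letters around layer `0`, continued by `+1`), and the frame `ctxFrame κ = flip ∘ cuboFrame`
(`cuboFrame` of `TwoShellIntegerModel`, composed with the coordinate sign flip of `κ` realised as the linear isometry of the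
signed permutation `(0, flipSigns flip)`).  The dictionary `ctxFrame_barlowPos`:
`ctxFrame κ (barlowPos 1 (√6/3) (ctxWord κ) m u w) = pt (ctxSite κ m u w)` for `|m| ≤ 2`
(through `cuboFrame_barlowPos`, `haggLabel (ctxWord κ) m = wordLabel κ m`).  [folklore]

## References
* T. C. Hales, *Dense Sphere Packings: a blueprint for formal proofs* (2012), §1.3. [HalesDSP2012]
-/

noncomputable section

namespace Literature.Geometry.DiscreteGeometry.TwoShellChart

open TwoShellCheck Literature.MathematicalPhysics.StatisticalMechanics

/-- The Hägg word of a context: its four letters at `-2, -1, 0, 1`, and `+1` elsewhere. [folklore] -/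
def ctxWord (κ : Ctx) : ℤ → ℤ := fun m =>
  if m = -2 then κ.2.1 else if m = -1 then κ.2.2.1 else if m = 0 then κ.2.2.2.1 else if m = 1 then κ.2.2.2.2 else 1

/-- A valid context has a Hägg word. [folklore] -/
theorem isHaggSeq_ctxWord {κ : Ctx} (h : ctxValid κ = true) : IsHaggSeq (ctxWord κ) := by
  unfold ctxValid at h
  simp only [List.all_cons, List.all_nil, Bool.and_true, Bool.and_eq_true, Bool.or_eq_true, beq_iff_eq] at h
  obtain ⟨h1, h2, h3, h4⟩ := h
  intro m
  unfold ctxWord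
  split_ifs <;> first | exact h1 | exact h2 | exact h3 | exact h4 | exact Or.inl rfl

/-- **The labels of the context word are `wordLabel`** for `|m| ≤ 2`. [folklore] -/
theorem haggLabel_ctxWord (κ : Ctx) {m : ℤ} (hm : -2 ≤ m ∧ m ≤ 2) : haggLabel (ctxWord κ) m = wordLabel κ m := by
  have hs0 := haggLabel_succ (ctxWord κ) 0
  have hs1 := haggLabel_succ (ctxWord κ) 1
  have hm1 := haggLabel_succ (ctxWord κ) (-1)
  have hm2 := haggLabel_succ (ctxWord κ) (-2)
  rw [zero_add, haggLabel_zero, zero_add] at hs0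
  norm_num at hs1 hm1 hm2
  have w0 : ctxWord κ 0 = κ.2.2.2.1 := by simp [ctxWord]
  have w1 : ctxWord κ 1 = κ.2.2.2.2 := by simp [ctxWord]
  have wm1 : ctxWord κ (-1) = κ.2.2.1 := by simp [ctxWord]
  have wm2 : ctxWord κ (-2) = κ.2.1 := by simp [ctxWord]
  obtain ⟨h1, h2⟩ := hm
  unfold wordLabel
  interval_cases m
  · simp only [show (-2 : ℤ) = 1 ↔ False by decide, show (-2 : ℤ) = 2 ↔ False by decide,
      show (-2 : ℤ) = -1 ↔ False by decide, if_false, if_true]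
    linarith [haggLabel_zero (ctxWord κ)]
  · simp only [show (-1 : ℤ) = 1 ↔ False by decide, show (-1 : ℤ) = 2 ↔ False by decide, if_false, if_true]
    linarith [haggLabel_zero (ctxWord κ)]
  · simp [haggLabel_zero]
  · simp only [if_true]; rw [hs0, w0]
  · simp only [show (2 : ℤ) = 1 ↔ False by decide, if_false, if_true]
    rw [hs1, hs0, w0, w1]

/-- The signs of the coordinate flip `flipVec k`. [folklore] -/
def flipSigns (k : Fin 4) : IVec :=
  match k with
  | 0 => (1, 1, 1)
  | 1 => (-1, 1, 1)
  | 2 => (1, -1, 1)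
  | 3 => (1, 1, -1)

/-- `flipVec k` is the signed permutation `(0, flipSigns k)`. [folklore] -/
theorem symApply_flipSigns (k : Fin 4) (z : IVec) : symApply (0, flipSigns k) z = flipVec k z := by
  obtain ⟨a, b, c⟩ := z
  fin_cases k <;> simp [symApply, permApply, flipSigns, flipVec]

/-- The signs of a flip are `±1`. [folklore] -/
theorem flipSigns_signs (k : Fin 4) : ((flipSigns k).1 = 1 ∨ (flipSigns k).1 = -1) ∧
    ((flipSigns k).2.1 = 1 ∨ (flipSigns k).2.1 = -1) ∧ ((flipSigns k).2.2 = 1 ∨ (flipSigns k).2.2 = -1) := by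
  fin_cases k <;> simp [flipSigns]

/-- The coordinate flip of a context as a linear isometry. [folklore] -/
def ctxFlip (k : Fin 4) : EuclideanSpace ℝ (Fin 3) →ₗᵢ[ℝ] EuclideanSpace ℝ (Fin 3) :=
  ⟨symLin (0, flipSigns k), norm_symLin (flipSigns_signs k).1 (flipSigns_signs k).2.1 (flipSigns_signs k).2.2⟩

/-- `ctxFlip` on model points is `flipVec`. [folklore] -/
theorem ctxFlip_pt (k : Fin 4) (z : IVec) : ctxFlip k (pt z) = pt (flipVec k z) := by
  show symLin (0, flipSigns k) (pt z) = _
  rw [symLin_pt, symApply_flipSigns]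

/-- **The frame of a context**: `flip ∘ cuboFrame`. [folklore] -/
def ctxFrame (κ : Ctx) : EuclideanSpace ℝ (Fin 3) →ₗᵢ[ℝ] EuclideanSpace ℝ (Fin 3) := (ctxFlip κ.1).comp cuboFrame

/-- The integer site formula of `TwoShellIntegerModel` is the site vector of `TwoShellPlacementCheck`. [folklore] -/
theorem barlowSiteInt_eq_toFun (m u w L : ℤ) : barlowSiteInt m u w L = IVec.toFun (siteVec m u w L) := by
  funext i; fin_cases i <;> simp [barlowSiteInt, siteVec, IVec.toFun]

/-- `cuboFrame` carries the template site to the model point of its site vector. [folklore] -/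
theorem cuboFrame_barlowPos_pt (s : ℤ → ℤ) (m u w : ℤ) :
    cuboFrame (barlowPos 1 (Real.sqrt 6 / 3) s m u w) = pt (siteVec m u w (haggLabel s m)) := by
  rw [cuboFrame_barlowPos, barlowSiteInt_eq_toFun]; rfl

/-- **The dictionary**: `ctxFrame κ (barlowPos 1 (√6/3) (ctxWord κ) m u w) = pt (ctxSite κ m u w)` for `|m| ≤ 2`. [folklore] -/
theorem ctxFrame_barlowPos (κ : Ctx) {m : ℤ} (hm : -2 ≤ m ∧ m ≤ 2) (u w : ℤ) :
    ctxFrame κ (barlowPos 1 (Real.sqrt 6 / 3) (ctxWord κ) m u w) = pt (ctxSite κ m u w) := by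
  unfold ctxFrame ctxSite
  rw [LinearIsometry.coe_comp, Function.comp_apply, cuboFrame_barlowPos_pt, haggLabel_ctxWord κ hm, ctxFlip_pt]

/-- The layer-`0`-adjacent labels of the context word: `L 0 = 0`, `L 1 = s₀`, `L (-1) = -s₋₁`. [folklore] -/
theorem haggLabel_ctxWord_small (κ : Ctx) (hv : ctxValid κ = true) {m : ℤ} (hm : -1 ≤ m ∧ m ≤ 1) :
    -1 ≤ haggLabel (ctxWord κ) m ∧ haggLabel (ctxWord κ) m ≤ 1 := by
  rw [haggLabel_ctxWord κ ⟨by omega, by omega⟩]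
  unfold ctxValid at hv
  simp only [List.all_cons, List.all_nil, Bool.and_true, Bool.and_eq_true, Bool.or_eq_true, beq_iff_eq] at hv
  obtain ⟨-, h2, h3, -⟩ := hv
  unfold wordLabel
  obtain ⟨ha, hb⟩ := hm
  interval_cases m
  · simp only [show (-1 : ℤ) = 1 ↔ False by decide, show (-1 : ℤ) = 2 ↔ False by decide, if_false, if_true]
    rcases h2 with h | h <;> rw [h] <;> norm_num
  · simp
  · simp only [if_true]; rcases h3 with h | h <;> rw [h] <;> norm_num

end Literature.Geometry.DiscreteGeometry.TwoShellChart

end
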